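import Summits.AnomalousDissipation.AnomalousDissipation.Theorems.MarginalStabilityChainStrainedLayerLawStubVorticityUniformBoundsE
import Summits.AnomalousDissipation.AnomalousDissipation.Theorems.MarginalStabilityChainStrainedLayerLawStubVorticityUniformBoundsF
import Summits.AnomalousDissipation.AnomalousDissipation.Theorems.MarginalStabilityChainStrainedLayerLawStubVorticityUniformBoundsG
import Summits.AnomalousDissipation.AnomalousDissipation.Theorems.MarginalStabilityChainStrainedLayerLawStubStrainWorkIdentity
import Mathlib.Analysis.Calculus.ParametricIntegral

/-!
# Stub `stub_vorticityUniformBounds` (crux stmt-AnomalousDissipation-3007, line `strain-work-sum-rule`) — tools H: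
# differentiation in time under the integral and Kato's `L¹`-antitonicity of the vorticity

Support file (`--supports stmt-AnomalousDissipation-3007`; registered sub-goal `stub_vorticityUniformBounds_kato`),
step (a) of the a-priori chain behind the stub, PROVED: for every classical solution `(u, v, p)` of the stretched
two-dimensional Navier–Stokes layer system on `(0, ∞)` (`ν, L > 0`; `u, v ∈ C²`, `p ∈ C¹`, `L`-periodic, shear far
field) with uniform exponential shear tails on compact time intervals,

  `∫_{x ∈ (0,L]} ∫_y |ω(t, x, y)| ≤ ∫_{x ∈ (0,L]} ∫_y |ω(s, x, y)|`   for `0 < s ≤ t`,   `ω = ∂ₓv − ∂_yu`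

(`stub_vorticityUniformBounds_kato`), i.e. the `L¹`-contraction of the conservation form
`∂ₜω + div(ω(u, v − y)) = νΔω`. Proof: along the solution, the weak vorticity balance (tools D) tested against
`j_ε′(ω)ψ_R` gives Kato's differential inequality (tools E) for `N_{ε,R}(τ) = ∫∫ j_ε(ω(τ))ψ_R`, whose time
derivative exists by tools F; its right-hand side is `A/R + εB(R)` uniformly on `[s/2, t + 1]` by the tails
(tools G); the mean value inequality, `ε → 0⁺`, and `R → ∞` (dominated convergence) conclude
(`kato_cutoff_step`, then the registered theorem). Consequently `∫∫|ω(t)| ≤ ∫∫|ω(1)|` for all `t ≥ 1`: the first of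
the three uniform bounds asked by the stub; the enstrophy and moment bounds remain (see the stub memo).

References: T. Kato's inequality; M. Ben-Artzi, Arch. Rational Mech. Anal. 128 (1994) (L¹ theory of 2-D
vorticity); A. J. Majda, A. L. Bertozzi, *Vorticity and Incompressible Flow*, CUP 2002, §1.4 (the stretched 2-D
class). All `[folklore]`.
-/

-- `Summit.<Summit>.<Problem>` is the tree's mandated summit-side namespace (CONVENTIONS §2); for this
-- single-conjunct summit the two coincide, so the duplicate is deliberate.
set_option linter.dupNamespace false

noncomputable section

open scoped Topology ENNReal
open Filter Set Function MeasureTheory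

namespace Summit.AnomalousDissipation.AnomalousDissipation.Theorems.StrainedLayerLaw.StrainWorkSumRule

open Literature.Analysis.FluidPDE Literature.Analysis.FluidPDE.StretchedLayer
open Summit.AnomalousDissipation.AnomalousDissipation.Theorems.MarginalStabilityChainStretchedVortexRows

/-! ## Differentiating the regularised, cut-off `L¹` norm of the vorticity in time -/

section TimeDerivative

/-- **Differentiation under the integral sign.** For `u, v` jointly `C²` on `(0,∞) × ℝ²`, `ε > 0`, a `C¹` cutoff
`ψ` with `|ψ| ≤ 1` vanishing for `|y| ≥ R′`, and `0 < lo < t < hi`: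
`d/dt ∫∫_{(0,L]×ℝ} j_ε(ω(t)) ψ = ∫∫ j_ε′(ω(t)) ψ (∂ₓb − ∂_ya)` with `a = ∂ₜu(t)`, `b = ∂ₜv(t)` (the integrand's time
derivative is continuous on `(0,∞) × ℝ²`, hence bounded on `[lo, hi] × [0, L] × [−R′, R′]`). [folklore] -/
theorem stub_vorticityUniformBounds_timeDerivative {u v : ℝ → ℝ → ℝ → ℝ}
    (hu : ContDiffOn ℝ 2 (fun q : ℝ × ℝ × ℝ => u q.1 q.2.1 q.2.2) (Ioi 0 ×ˢ univ))
    (hv : ContDiffOn ℝ 2 (fun q : ℝ × ℝ × ℝ => v q.1 q.2.1 q.2.2) (Ioi 0 ×ˢ univ)) {ε : ℝ} (hε : 0 < ε)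
    {ψ : ℝ → ℝ} (hψ : ContDiff ℝ 1 ψ) (hψ1 : ∀ y, |ψ y| ≤ 1) {R' : ℝ} (hψ0 : ∀ y, R' ≤ |y| → ψ y = 0)
    (L : ℝ) {lo hi t : ℝ} (hlo : 0 < lo) (ht : t ∈ Ioo lo hi) :
    HasDerivAt (fun s => ∫ q in Ioc 0 L ×ˢ univ, Real.sqrt (vorticity (u s) (v s) q.1 q.2 ^ 2 + ε ^ 2) * ψ q.2)
      (∫ q in Ioc 0 L ×ˢ univ, vorticity (u t) (v t) q.1 q.2 /
          Real.sqrt (vorticity (u t) (v t) q.1 q.2 ^ 2 + ε ^ 2) * ψ q.2 *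
        (dX (fun x y => deriv (fun s => v s x y) t) q.1 q.2 - dY (fun x y => deriv (fun s => u s x y) t) q.1 q.2))
      t := by
  obtain ⟨kato_sq_add_sq_pos, kato_sqrt_pos, kato_le_sqrt, kato_abs_le_sqrt, kato_sqrt_le, kato_abs_jprime_le_one,
    kato_jsecond_nonneg, kato_G_nonpos, kato_mul_jprime_sub_G, kato_hasDerivAt_j, kato_hasDerivAt_jprime,
    kato_hasDerivAt_G⟩ := kato_modulus_props
  have ht0 : 0 < t := hlo.trans ht.1
  have hpos : ∀ {s : ℝ}, s ∈ Ioo lo hi → 0 < s := fun hs => hlo.trans hs.1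
  have hSm : MeasurableSet (Ioc (0:ℝ) L ×ˢ (univ : Set ℝ)) := measurableSet_Ioc.prod MeasurableSet.univ
  -- the time derivative of the vorticity as a space–time field, and a bound for it near `t`
  set Ψ : ℝ × ℝ × ℝ → ℝ := fun q => dX (fun x y => deriv (fun s => v s x y) q.1) q.2.1 q.2.2 -
    dY (fun x y => deriv (fun s => u s x y) q.1) q.2.1 q.2.2 with hΨ
  have hΨc : ContinuousOn Ψ (Ioi 0 ×ˢ univ) := kato_continuousOn_vorticity_time hu hv
  have hK : IsCompact (Icc lo hi ×ˢ (Icc (0:ℝ) L ×ˢ Icc (-R') R')) :=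
    isCompact_Icc.prod (isCompact_Icc.prod isCompact_Icc)
  have hKO : Icc lo hi ×ˢ (Icc (0:ℝ) L ×ˢ Icc (-R') R') ⊆ Ioi (0:ℝ) ×ˢ (univ : Set (ℝ × ℝ)) :=
    fun q hq => ⟨hlo.trans_le hq.1.1, mem_univ _⟩
  obtain ⟨M, hM⟩ := hK.exists_bound_of_continuousOn (hΨc.mono hKO)
  have hM'0 : 0 ≤ max M 0 := le_max_right _ _
  -- continuity
  have cω : ∀ {s : ℝ}, 0 < s → Continuous fun q : ℝ × ℝ => vorticity (u s) (v s) q.1 q.2 := fun hs =>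
    (contDiff_one_vorticity (contDiff_slice hu (mem_Ioi.2 hs)) (contDiff_slice hv (mem_Ioi.2 hs))).continuous
  have cψ : Continuous ψ := hψ.continuous
  have csq : Continuous fun s : ℝ => Real.sqrt (s ^ 2 + ε ^ 2) := Real.continuous_sqrt.comp (by fun_prop)
  have cjp : Continuous fun s : ℝ => s / Real.sqrt (s ^ 2 + ε ^ 2) :=
    continuous_id.div csq fun s => (kato_sqrt_pos hε s).ne'
  have cΨt : Continuous fun q : ℝ × ℝ => Ψ (t, q) :=
    hΨc.comp_continuous (continuous_const.prodMk continuous_id) fun q => ⟨ht0, mem_univ _⟩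
  have hw1 : ∀ y : ℝ, |y| < R' → 1 ≤ Real.exp R' * Real.exp (-1 * |y|) := fun y hy => by
    rw [← Real.exp_add]; exact Real.one_le_exp (by linarith)
  have key := hasDerivAt_integral_of_dominated_loc_of_deriv_le (μ := volume.restrict (Ioc 0 L ×ˢ univ))
    (F := fun s q => Real.sqrt (vorticity (u s) (v s) q.1 q.2 ^ 2 + ε ^ 2) * ψ q.2)
    (F' := fun s q => vorticity (u s) (v s) q.1 q.2 / Real.sqrt (vorticity (u s) (v s) q.1 q.2 ^ 2 + ε ^ 2) *
      ψ q.2 * Ψ (s, q))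
    (bound := fun q => max M 0 * Real.exp R' * Real.exp (-1 * |q.2|)) (Ioo_mem_nhds ht.1 ht.2) ?_ ?_ ?_ ?_ ?_ ?_
  · exact key.2
  · filter_upwards [Ioo_mem_nhds ht.1 ht.2] with s hs
    exact ((csq.comp (cω (hpos hs))).mul (cψ.comp continuous_snd)).aestronglyMeasurable
  · exact kato_integrableOn_strip_of_eq_zero (R := R') ((csq.comp (cω ht0)).mul (cψ.comp continuous_snd))
      fun x _ y hy => by simp only [hψ0 y hy, mul_zero]
  · exact (((cjp.comp (cω ht0)).mul (cψ.comp continuous_snd)).mul cΨt).aestronglyMeasurable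
  · refine ae_restrict_of_forall_mem hSm ?_
    rintro ⟨x, y⟩ ⟨hx, -⟩ s hs
    rw [Real.norm_eq_abs]
    by_cases hy : R' ≤ |y|
    · simp only [hψ0 y hy, mul_zero, zero_mul, abs_zero]; positivity
    · push Not at hy
      have hq : ((s, x, y) : ℝ × ℝ × ℝ) ∈ Icc lo hi ×ˢ (Icc (0:ℝ) L ×ˢ Icc (-R') R') :=
        ⟨⟨hs.1.le, hs.2.le⟩, ⟨hx.1.le, hx.2⟩, abs_le.1 hy.le⟩
      have h1 : |Ψ (s, x, y)| ≤ max M 0 := (Real.norm_eq_abs _ ▸ hM _ hq).trans (le_max_left _ _)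
      have h2 := kato_abs_jprime_le_one hε (vorticity (u s) (v s) x y)
      have h3 := hψ1 y
      rw [abs_mul, abs_mul]
      calc |vorticity (u s) (v s) x y / Real.sqrt (vorticity (u s) (v s) x y ^ 2 + ε ^ 2)| * |ψ y| *
            |Ψ (s, x, y)| ≤ 1 * 1 * max M 0 :=
            mul_le_mul (mul_le_mul h2 h3 (abs_nonneg _) zero_le_one) h1 (abs_nonneg _) (by norm_num)
        _ = max M 0 * 1 := by ring
        _ ≤ max M 0 * (Real.exp R' * Real.exp (-1 * |y|)) := mul_le_mul_of_nonneg_left (hw1 y hy) hM'0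
        _ = max M 0 * Real.exp R' * Real.exp (-1 * |y|) := by ring
  · show IntegrableOn (fun q : ℝ × ℝ => max M 0 * Real.exp R' * Real.exp (-1 * |q.2|)) (Ioc 0 L ×ˢ univ)
    refine integrableOn_strip_of_abs_le_exp (C := max M 0 * Real.exp R') (k := 1) (by fun_prop) (by positivity)
      one_pos fun x _ y => ?_
    rw [abs_of_nonneg (by positivity)]
  · refine ae_restrict_of_forall_mem hSm ?_
    rintro ⟨x, y⟩ - s hs
    have hω := stub_vorticityUniformBounds_vorticityTime hu hv (hpos hs) x y
    have hj := (HasDerivAt.comp (h₂ := fun r => Real.sqrt (r ^ 2 + ε ^ 2)) (h := fun s => vorticity (u s) (v s) x y)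
      s (kato_hasDerivAt_j hε _) hω).mul_const (ψ y)
    refine hj.congr_deriv ?_
    simp only [hΨ]
    ring

end TimeDerivative

/-! ## The Kato inequality along a solution -/

section AlongSolution

variable {ν L : ℝ} {u v p : ℝ → ℝ → ℝ → ℝ}

/-- **Kato's differential inequality along a classical solution.** For a solution of the stretched layer system on
`(0, ∞)` (`ν ≥ 0`, `L > 0`), `t > 0`, `ε > 0` and a nonnegative `C¹` cutoff `ψ` vanishing for `|y| ≥ R′`:
`∫∫ j_ε′(ω(t))ψ (∂ₓ∂ₜv − ∂_y∂ₜu) ≤ ∫∫ (|ω| + ε)|v − y||ψ′| + ν∫∫ |∂_yω||ψ′|` (tools E applied to the slices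
at time `t`; the time-derivative slices are `C¹`, `x`-periodic and satisfy the momentum equations). [folklore] -/
theorem kato_slice_inequality (hsol : IsStretchedLayerNSSolutionOn (Ioi 0) ν 1 1 L u v p) (hν : 0 ≤ ν)
    (hL : 0 < L) {t : ℝ} (ht : 0 < t) {ε : ℝ} (hε : 0 < ε) {ψ : ℝ → ℝ} (hψ : ContDiff ℝ 1 ψ)
    (hψ0 : ∀ y, 0 ≤ ψ y) {R' : ℝ} (hψR : ∀ y, R' ≤ |y| → ψ y = 0) :
    ∫ q in Ioc 0 L ×ˢ univ, vorticity (u t) (v t) q.1 q.2 /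
          Real.sqrt (vorticity (u t) (v t) q.1 q.2 ^ 2 + ε ^ 2) * ψ q.2 *
        (dX (fun x y => deriv (fun s => v s x y) t) q.1 q.2 - dY (fun x y => deriv (fun s => u s x y) t) q.1 q.2) ≤
      (∫ q in Ioc 0 L ×ˢ univ, (|vorticity (u t) (v t) q.1 q.2| + ε) * |v t q.1 q.2 - q.2| * |deriv ψ q.2|) +
        ν * ∫ q in Ioc 0 L ×ˢ univ, |dY (vorticity (u t) (v t)) q.1 q.2| * |deriv ψ q.2| := by
  have ht' : t ∈ Ioi (0:ℝ) := ht
  refine stub_vorticityUniformBounds_katoStatic L ν R' ε (u t) (v t) (p t)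
    (fun x y => deriv (fun s => u s x y) t) (fun x y => deriv (fun s => v s x y) t) ψ hL hν hε
    (hsol.contDiff_u ht') (hsol.contDiff_v ht') (hsol.contDiff_p ht')
    (kato_contDiff_deriv_time_slice hsol.contDiffOn_u ht) (kato_contDiff_deriv_time_slice hsol.contDiffOn_v ht)
    (fun x y => ?_) (fun x y => ?_) (hsol.divFree t ht') (hsol.periodic_u t ht') (hsol.periodic_v t ht')
    (hsol.periodic_p t ht') (fun x y => ?_) hψ hψ0 hψR
  · have h := hsol.momentum_x t ht' x y
    rw [dT_of_isOpen isOpen_Ioi u ht', one_mul] at h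
    exact h
  · have h := hsol.momentum_y t ht' x y
    rw [dT_of_isOpen isOpen_Ioi v ht', one_mul, one_mul] at h
    exact h
  · exact kato_deriv_time_periodic (fun s hs x y => hsol.periodic_v s hs x y) ht x y

end AlongSolution

/-! ## The cut-off `L¹` norm of the vorticity does not increase, up to `O(1/R)` -/

section CutoffStep

variable {ν L : ℝ} {u v p : ℝ → ℝ → ℝ → ℝ}

/-- **One cutoff level.** Along a solution with shear tails `SliceTails C k` on `[s/2, t + 1]` (`0 < s < t`), for the
cutoff `ψ_R`, `R > 0`: `∫∫ |ω(t)|ψ_R ≤ ∫∫ |ω(s)|ψ_R + (t − s)·A/R`, `A = 2C_σC(∫∫(C + |y|)e^{−k|y|} + ν∫∫e^{−k|y|})`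
(differentiate `∫∫ j_ε(ω)ψ_R` in time, bound the derivative by tools E and `kato_rhs_bound`, integrate, and let
`ε → 0`). [folklore] -/
theorem kato_cutoff_step (hsol : IsStretchedLayerNSSolutionOn (Ioi 0) ν 1 1 L u v p) (hν : 0 < ν) (hL : 0 < L)
    {s t : ℝ} (hs : 0 < s) (hst : s < t) {C k : ℝ} (hk : 0 < k)
    (hST : ∀ τ ∈ Icc (s / 2) (t + 1), SliceTails C k (u τ) (v τ)) {Cσ : ℝ} (hCσ0 : 0 ≤ Cσ)
    (hCσ : ∀ x, |deriv Real.smoothTransition x| ≤ Cσ) {R : ℝ} (hR : 0 < R) :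
    ∫ q in Ioc 0 L ×ˢ univ, |vorticity (u t) (v t) q.1 q.2| *
        (Real.smoothTransition (2 - q.2 / R) * Real.smoothTransition (2 + q.2 / R)) ≤
      (∫ q in Ioc 0 L ×ˢ univ, |vorticity (u s) (v s) q.1 q.2| *
        (Real.smoothTransition (2 - q.2 / R) * Real.smoothTransition (2 + q.2 / R))) +
      (t - s) * ((2 * Cσ / R) * C * (∫ q in Ioc 0 L ×ˢ univ, (C + |q.2|) * Real.exp (-k * |q.2|)) +
        ν * ((2 * Cσ / R) * C * ∫ q in Ioc 0 L ×ˢ univ, Real.exp (-k * |q.2|))) := by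
  obtain ⟨kato_sq_add_sq_pos, kato_sqrt_pos, kato_le_sqrt, kato_abs_le_sqrt, kato_sqrt_le, kato_abs_jprime_le_one,
    kato_jsecond_nonneg, kato_G_nonpos, kato_mul_jprime_sub_G, kato_hasDerivAt_j, kato_hasDerivAt_jprime,
    kato_hasDerivAt_G⟩ := kato_modulus_props
  set ψ : ℝ → ℝ := fun y => Real.smoothTransition (2 - y / R) * Real.smoothTransition (2 + y / R) with hψdef
  -- properties of the cutoff
  have hψ : ContDiff ℝ 1 ψ := kato_cutoff_contDiff R
  have hψ0 : ∀ y, 0 ≤ ψ y := fun y => kato_cutoff_nonneg R y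
  have hψ1 : ∀ y, ψ y ≤ 1 := fun y => kato_cutoff_le_one R y
  have hψ1' : ∀ y, |ψ y| ≤ 1 := fun y => kato_cutoff_abs_le_one R y
  have hψR : ∀ y, 2 * R ≤ |y| → ψ y = 0 := fun y hy => kato_cutoff_eq_zero hR hy
  have hψ'b : ∀ y, |deriv ψ y| ≤ 2 * Cσ / R := fun y => kato_cutoff_deriv_bound hR hCσ y
  have hψ'0 : ∀ y, 2 * R < |y| → deriv ψ y = 0 := fun y hy => kato_cutoff_deriv_eq_zero_of_gt hR hy
  have hD : 0 ≤ 2 * Cσ / R := by positivity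
  have hC : 0 ≤ C := (hST s ⟨by linarith, by linarith⟩).nonneg
  -- notation
  set ω : ℝ → ℝ → ℝ → ℝ := fun τ => vorticity (u τ) (v τ) with hωdef
  set IW : ℝ := ∫ q in Ioc 0 L ×ˢ univ, (C + |q.2|) * Real.exp (-k * |q.2|) with hIW
  set Ik : ℝ := ∫ q in Ioc 0 L ×ˢ univ, Real.exp (-k * |q.2|) with hIk
  set IR : ℝ := ∫ q in Ioc 0 L ×ˢ univ, Real.exp (-(1 / R) * |q.2|) with hIR
  set A : ℝ := (2 * Cσ / R) * C * IW + ν * ((2 * Cσ / R) * C * Ik) with hA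
  set B : ℝ := (2 * Cσ / R) * (C + 2 * R) * Real.exp 2 * IR with hB
  set Q : ℝ := ∫ q in Ioc 0 L ×ˢ univ, ψ q.2 with hQ
  have hIR0 : 0 ≤ IR := setIntegral_nonneg (measurableSet_Ioc.prod MeasurableSet.univ) fun q _ => (Real.exp_pos _).le
  have hB0 : 0 ≤ B := by positivity
  have hQ0 : 0 ≤ Q := setIntegral_nonneg (measurableSet_Ioc.prod MeasurableSet.univ) fun q _ => hψ0 _
  -- slice facts on `[s/2, t+1]`
  have hpos : ∀ {τ : ℝ}, τ ∈ Icc (s / 2) (t + 1) → 0 < τ := fun hτ => lt_of_lt_of_le (by linarith) hτ.1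
  have cωτ : ∀ {τ : ℝ}, 0 < τ → Continuous fun q : ℝ × ℝ => ω τ q.1 q.2 := fun hτ =>
    (contDiff_one_vorticity (hsol.contDiff_u (mem_Ioi.2 hτ)) (hsol.contDiff_v (mem_Ioi.2 hτ))).continuous
  have hωb : ∀ {τ : ℝ}, τ ∈ Icc (s / 2) (t + 1) → ∀ x y, |ω τ x y| ≤ C * Real.exp (-k * |y|) :=
    fun hτ x y => tails_abs_vorticity_le (hST _ hτ) x y
  have cψ : Continuous ψ := hψ.continuous
  have iωψ : ∀ {τ : ℝ}, 0 < τ → IntegrableOn (fun q : ℝ × ℝ => |ω τ q.1 q.2| * ψ q.2) (Ioc 0 L ×ˢ univ) :=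
    fun hτ => kato_integrableOn_strip_of_eq_zero (R := 2 * R) ((cωτ hτ).abs.mul (cψ.comp continuous_snd))
      fun x _ y hy => by simp only [hψR y hy, mul_zero]
  have iQ : IntegrableOn (fun q : ℝ × ℝ => ψ q.2) (Ioc 0 L ×ˢ univ) :=
    kato_integrableOn_strip_of_eq_zero (R := 2 * R) (cψ.comp continuous_snd) fun x _ y hy => hψR y hy
  -- the ε-level inequality
  have hεlevel : ∀ ε : ℝ, 0 < ε →
      ∫ q in Ioc 0 L ×ˢ univ, |ω t q.1 q.2| * ψ q.2 ≤
        (∫ q in Ioc 0 L ×ˢ univ, |ω s q.1 q.2| * ψ q.2) + ε * Q + (t - s) * (A + ε * B) := by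
    intro ε hε
    set N : ℝ → ℝ := fun τ => ∫ q in Ioc 0 L ×ˢ univ, Real.sqrt (ω τ q.1 q.2 ^ 2 + ε ^ 2) * ψ q.2 with hN
    -- derivative and its bound on `(s/2, t+1)`
    have hderiv : ∀ τ ∈ Ioo (s / 2) (t + 1), ∃ Dτ, HasDerivAt N Dτ τ ∧ Dτ ≤ A + ε * B := by
      intro τ hτ
      have hτ0 : 0 < τ := hpos (Ioo_subset_Icc_self hτ)
      refine ⟨_, stub_vorticityUniformBounds_timeDerivative hsol.contDiffOn_u hsol.contDiffOn_v hε hψ hψ1' hψR L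
        (by linarith : 0 < s / 2) hτ, ?_⟩
      have h1 := kato_slice_inequality hsol hν.le hL hτ0 hε hψ hψ0 hψR
      have h2 := stub_vorticityUniformBounds_rhsBound (L := L) hk (hST τ (Ioo_subset_Icc_self hτ)) (hsol.contDiff_u (mem_Ioi.2 hτ0))
        (hsol.contDiff_v (mem_Ioi.2 hτ0)) (hsol.divFree τ (mem_Ioi.2 hτ0)) hψ hR hD hψ'b hψ'0 hε.le hν.le
      simp only [hA, hB]
      linarith
    -- mean value inequality on `[s, t]`
    have hcont : ContinuousOn N (Icc s t) := fun τ hτ =>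
      (hderiv τ ⟨by linarith [hτ.1], by linarith [hτ.2]⟩).choose_spec.1.continuousAt.continuousWithinAt
    have hdiff : DifferentiableOn ℝ N (interior (Icc s t)) := by
      rw [interior_Icc]
      exact fun τ hτ => (hderiv τ ⟨by linarith [hτ.1], by linarith [hτ.2]⟩).choose_spec.1.differentiableAt
        |>.differentiableWithinAt
    have hbound : ∀ τ ∈ interior (Icc s t), deriv N τ ≤ A + ε * B := by
      rw [interior_Icc]
      intro τ hτ
      obtain ⟨Dτ, hD1, hD2⟩ := hderiv τ ⟨by linarith [hτ.1], by linarith [hτ.2]⟩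
      rw [hD1.deriv]; exact hD2
    have hMVT := (convex_Icc s t).image_sub_le_mul_sub_of_deriv_le hcont hdiff hbound s
      (left_mem_Icc.2 hst.le) t (right_mem_Icc.2 hst.le) hst.le
    -- compare `N` with the cut-off `L¹` norms
    have iN : ∀ {τ : ℝ}, 0 < τ →
        IntegrableOn (fun q : ℝ × ℝ => Real.sqrt (ω τ q.1 q.2 ^ 2 + ε ^ 2) * ψ q.2) (Ioc 0 L ×ˢ univ) :=
      fun hτ => kato_integrableOn_strip_of_eq_zero (R := 2 * R)
        ((Real.continuous_sqrt.comp (((cωτ hτ).pow 2).add continuous_const)).mul (cψ.comp continuous_snd))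
        fun x _ y hy => by simp only [hψR y hy, mul_zero]
    have hNt : ∫ q in Ioc 0 L ×ˢ univ, |ω t q.1 q.2| * ψ q.2 ≤ N t :=
      integral_mono (iωψ (by linarith)) (iN (by linarith)) fun q =>
        mul_le_mul_of_nonneg_right (kato_abs_le_sqrt _ _) (hψ0 _)
    have hNs : N s ≤ (∫ q in Ioc 0 L ×ˢ univ, |ω s q.1 q.2| * ψ q.2) + ε * Q := by
      simp only [hN, hQ]
      have iQε : IntegrableOn (fun q : ℝ × ℝ => ε * ψ q.2) (Ioc 0 L ×ˢ univ) := iQ.const_mul ε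
      have iS : IntegrableOn (fun q : ℝ × ℝ => |ω s q.1 q.2| * ψ q.2 + ε * ψ q.2) (Ioc 0 L ×ˢ univ) :=
        (iωψ hs).add iQε
      rw [← integral_const_mul, ← integral_add (iωψ hs) iQε]
      refine integral_mono (iN hs) iS fun q => ?_
      simp only
      have h1 := kato_sqrt_le hε (ω s q.1 q.2)
      nlinarith [hψ0 q.2]
    nlinarith [hMVT, hNt, hNs]
  -- let `ε → 0`
  refine le_of_forall_pos_le_add fun δ hδ => ?_
  set ε : ℝ := min 1 (δ / (Q + (t - s) * B + 1)) with hεdef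
  have hden : 0 < Q + (t - s) * B + 1 := by nlinarith [hQ0, hB0, hst]
  have hε : 0 < ε := lt_min one_pos (div_pos hδ hden)
  have hε1 : ε * (Q + (t - s) * B + 1) ≤ δ := by
    have : ε ≤ δ / (Q + (t - s) * B + 1) := min_le_right _ _
    rwa [le_div_iff₀ hden] at this
  have key := hεlevel ε hε
  have : ε * Q + (t - s) * (ε * B) ≤ δ := by nlinarith [hε.le, hQ0, hB0]
  simp only [hA] at key ⊢
  nlinarith [key, this]

end CutoffStep

/-! ## Kato's `L¹`-antitonicity of the vorticity -/

section Kato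

/-- **Kato's `L¹` bound for the vorticity of the stretched layer (registered sub-goal
`stub_vorticityUniformBounds_kato`).** For every classical solution of the stretched two-dimensional
Navier–Stokes layer system on `(0, ∞)` (`ν, L > 0`) with uniform exponential shear tails on compact time
intervals, the `L¹` norm of the vorticity over one period cell does not increase:
`∫_{(0,L]} ∫_ℝ |ω(t)| ≤ ∫_{(0,L]} ∫_ℝ |ω(s)|` for `0 < s ≤ t` (`ω = ∂ₓv − ∂_yu`). This is the `L¹`-contraction of
the conservation form `∂ₜω + div(ω(u, v − y)) = νΔω`, proved in weak-in-space form (tools C–E), differentiated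
under the integral with the regularised modulus `j_ε` and the cutoff `ψ_R` (this file), then `ε → 0` and
`R → ∞` (dominated convergence; the cutoff error is `O(1/R)` by the tails). In particular
`∫∫|ω(t)| ≤ ∫∫|ω(1)|` for `t ≥ 1`: the first of the three uniform bounds of the stub. [folklore] -/
theorem stub_vorticityUniformBounds_kato : ∀ (ν L : ℝ), 0 < ν → 0 < L → ∀ (u v p : ℝ → ℝ → ℝ → ℝ),
    IsStretchedLayerNSSolutionOn (Ioi 0) ν 1 1 L u v p →
    (∀ a b : ℝ, 0 < a → a < b → ExpTails (Icc a b) u v) →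
      ∀ s t : ℝ, 0 < s → s ≤ t →
        (∫ x in Ioc 0 L, ∫ y, |vorticity (u t) (v t) x y|) ≤ ∫ x in Ioc 0 L, ∫ y, |vorticity (u s) (v s) x y| := by
  intro ν L hν hL u v p hsol htails s t hs hst
  rcases eq_or_lt_of_le hst with rfl | hst'
  · exact le_rfl
  obtain ⟨C, k, hk, hCk⟩ := htails (s / 2) (t + 1) (by positivity) (by linarith)
  have hST : ∀ τ ∈ Icc (s / 2) (t + 1), SliceTails C k (u τ) (v τ) := fun τ hτ => (hCk τ hτ).1
  obtain ⟨Cσ, hCσ0, hCσ⟩ := kato_smoothTransition_deriv_bound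
  have hsI : s ∈ Icc (s / 2) (t + 1) := ⟨by linarith, by linarith⟩
  have htI : t ∈ Icc (s / 2) (t + 1) := ⟨by linarith, by linarith⟩
  have hC : 0 ≤ C := (hST s hsI).nonneg
  -- continuity and integrability of `|ω(τ)|` on the strip
  have cω : ∀ {τ : ℝ}, 0 < τ → Continuous fun q : ℝ × ℝ => vorticity (u τ) (v τ) q.1 q.2 := fun hτ =>
    (contDiff_one_vorticity (hsol.contDiff_u (mem_Ioi.2 hτ)) (hsol.contDiff_v (mem_Ioi.2 hτ))).continuous
  have iω : ∀ {τ : ℝ}, τ ∈ Icc (s / 2) (t + 1) →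
      IntegrableOn (fun q : ℝ × ℝ => |vorticity (u τ) (v τ) q.1 q.2|) (Ioc 0 L ×ˢ univ) := fun {τ} hτ =>
    integrableOn_strip_of_abs_le_exp (cω (lt_of_lt_of_le (by linarith) hτ.1)).abs hC hk fun x _ y => by
      rw [abs_abs]; exact tails_abs_vorticity_le (hST τ hτ) x y
  rw [integral_iterated_eq_strip (iω htI), integral_iterated_eq_strip (iω hsI)]
  -- `R → ∞` in the cut-off norms (dominated convergence)
  have hlim : ∀ {τ : ℝ}, τ ∈ Icc (s / 2) (t + 1) → Tendsto (fun R : ℝ => ∫ q in Ioc 0 L ×ˢ univ,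
      |vorticity (u τ) (v τ) q.1 q.2| * (Real.smoothTransition (2 - q.2 / R) * Real.smoothTransition (2 + q.2 / R)))
      atTop (𝓝 (∫ q in Ioc 0 L ×ˢ univ, |vorticity (u τ) (v τ) q.1 q.2|)) := by
    intro τ hτ
    have hτ0 : 0 < τ := lt_of_lt_of_le (by linarith) hτ.1
    refine tendsto_integral_filter_of_dominated_convergence (fun q => |vorticity (u τ) (v τ) q.1 q.2|) ?_ ?_
      (iω hτ) ?_
    · exact Eventually.of_forall fun R =>
        ((cω hτ0).abs.mul ((kato_cutoff_contDiff R).continuous.comp continuous_snd)).aestronglyMeasurable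
    · refine Eventually.of_forall fun R => Eventually.of_forall fun q => ?_
      rw [Real.norm_eq_abs, abs_mul, abs_abs]
      exact mul_le_of_le_one_right (abs_nonneg _) (kato_cutoff_abs_le_one R q.2)
    · refine Eventually.of_forall fun q => tendsto_const_nhds.congr' ?_
      filter_upwards [eventually_ge_atTop |q.2|, eventually_gt_atTop (0:ℝ)] with R h1 h2
      rw [kato_cutoff_eq_one h2 h1, mul_one]
  -- the cutoff error is `O(1/R)`
  set K : ℝ := 2 * Cσ * C * (∫ q in Ioc 0 L ×ˢ univ, (C + |q.2|) * Real.exp (-k * |q.2|)) +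
    ν * (2 * Cσ * C * ∫ q in Ioc 0 L ×ˢ univ, Real.exp (-k * |q.2|)) with hK
  have hA : Tendsto (fun R : ℝ => (t - s) * ((2 * Cσ / R) * C *
      (∫ q in Ioc 0 L ×ˢ univ, (C + |q.2|) * Real.exp (-k * |q.2|)) +
      ν * ((2 * Cσ / R) * C * ∫ q in Ioc 0 L ×ˢ univ, Real.exp (-k * |q.2|)))) atTop (𝓝 0) := by
    have h1 : Tendsto (fun R : ℝ => (t - s) * K * R⁻¹) atTop (𝓝 ((t - s) * K * 0)) :=
      tendsto_inv_atTop_zero.const_mul _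
    rw [mul_zero] at h1
    refine h1.congr' ?_
    filter_upwards [eventually_gt_atTop (0:ℝ)] with R hR
    rw [hK, div_eq_mul_inv]
    ring
  -- the cutoff step, eventually in `R`
  have hmain : ∀ᶠ R : ℝ in atTop, (∫ q in Ioc 0 L ×ˢ univ, |vorticity (u t) (v t) q.1 q.2| *
        (Real.smoothTransition (2 - q.2 / R) * Real.smoothTransition (2 + q.2 / R))) ≤
      (∫ q in Ioc 0 L ×ˢ univ, |vorticity (u s) (v s) q.1 q.2| *
        (Real.smoothTransition (2 - q.2 / R) * Real.smoothTransition (2 + q.2 / R))) +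
      (t - s) * ((2 * Cσ / R) * C * (∫ q in Ioc 0 L ×ˢ univ, (C + |q.2|) * Real.exp (-k * |q.2|)) +
        ν * ((2 * Cσ / R) * C * ∫ q in Ioc 0 L ×ˢ univ, Real.exp (-k * |q.2|))) := by
    filter_upwards [eventually_gt_atTop (0:ℝ)] with R hR
    exact kato_cutoff_step hsol hν hL hs hst' hk hST hCσ0 hCσ hR
  have h2 := (hlim hsI).add hA
  rw [add_zero] at h2
  exact le_of_tendsto_of_tendsto (hlim htI) h2 hmain

end Kato

end Summit.AnomalousDissipation.AnomalousDissipation.Theorems.StrainedLayerLaw.StrainWorkSumRule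

end
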